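import Mathlib
import Summits.Ventures.FusionMHD.Models.RwmFRS1Eq
import Summits.Ventures.FusionMHD.Models.TearingFRS1EqSuydamInstances
import HarnessLib

/-!
# F3.σ row «F3.σ-NEWCOMB-RES64-FRS1-EQ-UNSTABLE»: the helicity `(m, n) = (6, 4)` (`k = −4/5`) of the FORCE-BALANCED MODEL
# M_RWM,eq (`RwmFRS1.Eq.Peq = EqSigmaR5.hl5.toProfile`) is resonant at `r_s² = 1/14`, INSIDE the Suydam-violating core
# (`r_s²(1 + r_s²) = 15/196 < 16/196 = 4c²`), hence admits a NEGATIVE-ENERGY internal displacement (Newcomb–Suydam necessity)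

The `m = 6` companion of gridfusion-model-7's `EqSuydam.exists_negative_energy_32_R5` (`TearingFRS1EqSuydamInstances.lean`,
same resonant surface, helicity `(3, 2)`), recorded here so that the tree DECIDES every helicity `(m, n)` with `n ≤ 4` that is
resonant inside the plasma of M_RWM,eq: Newcomb-STABLE by lit-4's η-rows `RwmFRS1EqRes<mn>Eta.lean` for `(2,1)`, `(4,2)`,
`(5,2)`, `(5,3)`, `(6,3)`, `(7,3)`, `(8,3)`, `(7,4)`, `(8,4)`, `(9,4)`, `(10,4)`, `(11,4)` (all with `r_s² ≥ 4/21 > t_S`), and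
UNSTABLE in the Newcomb–Suydam sense for the two core-resonant ones `(3,2)`, `(6,4)` (`r_s² = 1/14 < t_S = (√65 − 7)/14`).
One `exact` into model-7's `EqSuydam.exists_negative_energy` (which applies lit-3's tree theorem
`ScrewPinch.Profile.suydamNecessity_holds`).  gridfusion-lit-4 (g13), 2026-08-28.  0 kit, 0 facts. [instance data]

THREE COLUMNS (never merged).  CERTIFIED: existence of a `C¹` displacement, compactly supported in `(0, 1)`, with
`∫₀¹ (f ξ′² + g ξ²) dr < 0` for `(m, k) = (6, −4/5)` in MODEL M_RWM,eq.  VALIDATED: nothing numerical is used.  MODELLED: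
straight periodic cylinder `2πR₀`, `R₀ = 5a`, ideal MHD, one helicity; «unstable» = failure of Newcomb's non-negativity for
this helicity class; no growth rate; the toroidal `(1 − q²)` Mercier factor reverses the core sign
(`EqSuydam.mercierCircularCriterion5`); nothing about a torus or a device.
[cite: Freidberg2014, §11.5.2 eq. (11.109)]
-/

noncomputable section

open Real Set
open Literature.MathematicalPhysics.MHD Literature.MathematicalPhysics.MHD.ScrewPinch

namespace Summit.Ventures.FusionMHD.Models

namespace RwmFRS1

namespace EqRes64

open TearingFRS1 TearingFRS1.EqSuydam

/-- **THE `(6,4)` HELICITY OF M_RWM,eq HAS A NEGATIVE-ENERGY INTERNAL DISPLACEMENT** (resonant at `r_s = √(1/14)` in the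
Suydam-violating core).  MODELLED: straight cylinder, ideal MHD; nothing about a device. [instance data] -/
theorem exists_negative_energy_64_eq :
    ∃ ξ : ℝ → ℝ, ContDiff ℝ 1 ξ ∧ tsupport ξ ⊆ Ioo 0 1 ∧ Eq.Peq.fluidEnergy 6 (-4 / 5) 1 ξ < 0 := by
  have hr₀ : 0 < Real.sqrt (1 / 14) := Real.sqrt_pos.2 (by norm_num)
  have hsq : Real.sqrt (1 / 14) ^ 2 = 1 / 14 := Real.sq_sqrt (by norm_num)
  have hr₀1 : Real.sqrt (1 / 14) < 1 := by nlinarith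
  have hk : (-(6 * (1 / 7 : ℝ)) / (1 + Real.sqrt (1 / 14) ^ 2)) = -4 / 5 := by rw [hsq]; norm_num
  have hcore : Real.sqrt (1 / 14) ^ 2 < tS (1 / 7) := by
    rw [← mul_one_add_lt_iff (sq_nonneg _) (1 / 7), hsq]; norm_num
  rw [Eq.Peq, eqProfile_one_seventh, ← hk]
  exact exists_negative_energy (by norm_num) hr₀ hr₀1 (by norm_num) hcore

end EqRes64

end RwmFRS1

end Summit.Ventures.FusionMHD.Models

end
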